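import Literature.Computability.ImplicitComplexity.SoftTypeAssignmentMachine
import Literature.Computability.ImplicitComplexity.SoftTypeAssignmentRelN
import HarnessLib

/-!
# A sharing abstract machine for `STA₊`, II: labelled leftmost steps and their determinism

Preparations for the completeness of the machine `STA.KAM` (GMR08 = Gaboardi–Marion–Ronchi
Della Rocca 2008, Table 6 / Lemma 5.4): the leftmost-outermost strategy of `Λ₊` is deterministic
up to the choices made at head sums, so a leftmost evaluation is determined by its sequence of
LABELS (`none` for a `β`-step or an inner step, `some b` for a choice). This file introduces

* `STA.HdL`, `STA.LmoL` — head / leftmost steps carrying their label, equivalent to `Hd`/`Lmo`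
  (`Lmo.exists_label`, `LmoL.lmo`), and **deterministic given the label**
  (`LmoL.deterministic`);
* `STA.RelL` — labelled leftmost sequences, obtained from counted ones (`RelL.of_relN`);
* `STA.spineHead` — the head of an application spine, with the shape lemmas used to rule out
  the rejecting configurations of the machine on evaluations that end in `0`
  (`HdL.spineHead`, `LmoL.varApps_shape`, `RelL.lams_varApps_ne_zero`, …).

## References

* [GaboardiMarionRonchidellarocca2008] GMR08, §5.1 (the machine follows the leftmost strategy,
  the `(L)/(R)` rules are its only nondeterminism).
-/

namespace Literature.Computability.ImplicitComplexity

namespace STA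

/-! ### Labelled steps -/

/-- Head steps with their label: `none` for `β`, `some false`/`some true` for the left/right
choice at a head sum. [cite: GaboardiMarionRonchidellarocca2008, Table 6 ((β), (L), (R))] -/
inductive HdL : Option Bool → Term → Term → Prop
  | beta (M N : Term) : HdL none (.app (.lam M) N) (M.subst0 N)
  | choiceL (M N : Term) : HdL (some false) (.sum M N) M
  | choiceR (M N : Term) : HdL (some true) (.sum M N) N
  | appL {b : Option Bool} {M M' : Term} (N : Term) (h : HdL b M M') : HdL b (.app M N) (.app M' N)

/-- Leftmost-outermost steps with their label (inner steps inherit the label of their head step).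
[cite: GaboardiMarionRonchidellarocca2008, §5.1] -/
inductive LmoL : Option Bool → Term → Term → Prop
  | hd {b : Option Bool} {M M' : Term} (h : HdL b M M') : LmoL b M M'
  | lam {b : Option Bool} {M M' : Term} (h : LmoL b M M') : LmoL b (.lam M) (.lam M')
  | appL {b : Option Bool} {M M' : Term} (N : Term) (hM : Neutral M) (h : LmoL b M M') : LmoL b (.app M N) (.app M' N)
  | appR {b : Option Bool} {M N N' : Term} (hM : Neutral M) (hn : Normal M) (h : LmoL b N N') :
      LmoL b (.app M N) (.app M N')

/-- Forgetting the label of a head step. [folklore] -/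
theorem HdL.toHd {b : Option Bool} {M N : Term} (h : HdL b M N) : Hd M N := by
  induction h with
  | beta M N => exact Hd.beta M N
  | choiceL M N => exact Hd.choiceL M N
  | choiceR M N => exact Hd.choiceR M N
  | appL N _ ih => exact Hd.appL N ih

/-- Every head step has a label. [folklore] -/
theorem Hd.exists_label {M N : Term} (h : Hd M N) : ∃ b, HdL b M N := by
  induction h with
  | beta M N => exact ⟨none, HdL.beta M N⟩
  | choiceL M N => exact ⟨some false, HdL.choiceL M N⟩
  | choiceR M N => exact ⟨some true, HdL.choiceR M N⟩
  | appL N _ ih => obtain ⟨b, hb⟩ := ih; exact ⟨b, HdL.appL N hb⟩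

/-- Forgetting the label of a leftmost step. [folklore] -/
theorem LmoL.lmo {b : Option Bool} {M N : Term} (h : LmoL b M N) : Lmo M N := by
  induction h with
  | hd h => exact Lmo.hd h.toHd
  | lam _ ih => exact Lmo.lam ih
  | appL N hM _ ih => exact Lmo.appL N hM ih
  | appR hM hn _ ih => exact Lmo.appR hM hn ih

/-- Every leftmost step has a label. [folklore] -/
theorem Lmo.exists_label {M N : Term} (h : Lmo M N) : ∃ b, LmoL b M N := by
  induction h with
  | hd h => obtain ⟨b, hb⟩ := h.exists_label; exact ⟨b, LmoL.hd hb⟩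
  | lam _ ih => obtain ⟨b, hb⟩ := ih; exact ⟨b, LmoL.lam hb⟩
  | appL N hM _ ih => obtain ⟨b, hb⟩ := ih; exact ⟨b, LmoL.appL N hM hb⟩
  | appR hM hn _ ih => obtain ⟨b, hb⟩ := ih; exact ⟨b, LmoL.appR hM hn hb⟩

/-- Head steps are deterministic given their label. [folklore] -/
theorem HdL.deterministic {b : Option Bool} {M N₁ N₂ : Term} (h₁ : HdL b M N₁) (h₂ : HdL b M N₂) : N₁ = N₂ := by
  induction h₁ generalizing N₂ with
  | beta M N =>
    generalize e : Term.app (.lam M) N = T at h₂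
    cases h₂ with
    | beta M' N' =>
      simp only [Term.app.injEq, Term.lam.injEq] at e
      obtain ⟨rfl, rfl⟩ := e
      rfl
    | appL N' h =>
      simp only [Term.app.injEq] at e
      obtain ⟨rfl, rfl⟩ := e
      cases h
  | choiceL M N =>
    generalize e : Term.sum M N = T at h₂
    cases h₂ with
    | choiceL M' N' =>
      simp only [Term.sum.injEq] at e
      exact e.1
    | _ => simp at e
  | choiceR M N =>
    generalize e : Term.sum M N = T at h₂
    cases h₂ with
    | choiceR M' N' =>
      simp only [Term.sum.injEq] at e
      exact e.2
    | _ => simp at e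
  | appL N h ih =>
    generalize e : Term.app _ N = T at h₂
    cases h₂ with
    | beta M' N' =>
      simp only [Term.app.injEq] at e
      obtain ⟨rfl, rfl⟩ := e
      cases h
    | appL N' h' =>
      simp only [Term.app.injEq] at e
      obtain ⟨rfl, rfl⟩ := e
      rw [ih h']
    | _ => simp at e

/-- **Leftmost steps are deterministic given their label.** [cite: GaboardiMarionRonchidellarocca2008, §5.1] -/
theorem LmoL.deterministic {b : Option Bool} {M N₁ N₂ : Term} (h₁ : LmoL b M N₁) (h₂ : LmoL b M N₂) : N₁ = N₂ := by
  induction h₁ generalizing N₂ with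
  | hd h =>
    cases h₂ with
    | hd h' => exact h.deterministic h'
    | lam _ => cases h
    | appL N hM h' =>
      cases h with
      | beta => cases hM
      | appL _ h => exact absurd h.toHd (fun hh => hM.not_hd hh)
    | appR hM hn h' =>
      cases h with
      | beta => cases hM
      | appL _ h => exact absurd h.toHd (fun hh => hM.not_hd hh)
  | lam _ ih =>
    cases h₂ with
    | hd h' => cases h'
    | lam h' => rw [ih h']
  | appL N hM h ih =>
    cases h₂ with
    | hd h' =>
      cases h' with
      | beta => cases hM
      | appL _ h' => exact absurd h'.toHd (fun hh => hM.not_hd hh)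
    | appL _ _ h' => rw [ih h']
    | appR _ hn h' => exact absurd h.lmo.red (hn _)
  | appR hM hn h ih =>
    cases h₂ with
    | hd h' =>
      cases h' with
      | beta => cases hM
      | appL _ h' => exact absurd h'.toHd (fun hh => hM.not_hd hh)
    | appL _ _ h' => exact absurd h'.lmo.red (hn _)
    | appR _ _ h' => rw [ih h']

/-- A labelled head step of the head lifts through pending arguments. [folklore] -/
theorem HdL.apps {b : Option Bool} {M M' : Term} (h : HdL b M M') :
    ∀ (args : List Term), HdL b (KAM.apps M args) (KAM.apps M' args)
  | [] => h
  | a :: as => HdL.apps (HdL.appL a h) as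

/-- A labelled leftmost step lifts under entered abstractions. [folklore] -/
theorem LmoL.lams {b : Option Bool} {M M' : Term} (h : LmoL b M M') : ∀ (D : ℕ), LmoL b (KAM.lams D M) (KAM.lams D M')
  | 0 => h
  | D + 1 => LmoL.lam (LmoL.lams h D)

/-! ### Labelled sequences -/

/-- Labelled leftmost sequences (head first). [folklore] -/
inductive RelL : List (Option Bool) → Term → Term → Prop
  | nil (M : Term) : RelL [] M M
  | cons {b : Option Bool} {bs : List (Option Bool)} {M N P : Term} (h : LmoL b M N) (hs : RelL bs N P) :
      RelL (b :: bs) M P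

/-- Appending one labelled step at the end. [folklore] -/
theorem RelL.snoc {bs : List (Option Bool)} {M N P : Term} (h : RelL bs M N) {b : Option Bool} (hs : LmoL b N P) :
    RelL (bs ++ [b]) M P := by
  induction h with
  | nil M => exact RelL.cons hs (RelL.nil _)
  | cons h' _ ih => exact RelL.cons h' (ih hs)

/-- A counted leftmost sequence has a labelling of the same length. [folklore] -/
theorem RelL.of_relN {k : ℕ} {M N : Term} (h : RelN Lmo k M N) : ∃ bs : List (Option Bool), bs.length = k ∧ RelL bs M N := by
  induction h with
  | refl M => exact ⟨[], rfl, RelL.nil M⟩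
  | tail _ hs ih =>
    obtain ⟨bs, hlen, hbs⟩ := ih
    obtain ⟨b, hb⟩ := hs.exists_label
    exact ⟨bs ++ [b], by simp [hlen], hbs.snoc hb⟩

/-- A labelled sequence is a reduction. [folklore] -/
theorem RelL.reduces {bs : List (Option Bool)} {M N : Term} (h : RelL bs M N) : Reduces M N := by
  induction h with
  | nil M => exact Relation.ReflTransGen.refl
  | cons h' _ ih => exact (Relation.ReflTransGen.single h'.lmo.red).trans ih

/-- The oracle of a labelling: its choice bits, in order. [folklore] -/
def labelBits (bs : List (Option Bool)) : List Bool := bs.filterMap id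

/-- Bits of a cons. [folklore] -/
@[simp] theorem labelBits_cons_none (bs : List (Option Bool)) : labelBits (none :: bs) = labelBits bs := by
  simp [labelBits]

/-- Bits of a cons. [folklore] -/
@[simp] theorem labelBits_cons_some (b : Bool) (bs : List (Option Bool)) :
    labelBits (some b :: bs) = b :: labelBits bs := by
  simp [labelBits]

/-- There are at most as many bits as labels. [folklore] -/
theorem length_labelBits_le (bs : List (Option Bool)) : (labelBits bs).length ≤ bs.length :=
  List.length_filterMap_le _ _

/-! ### Spines and shapes -/

/-- The head of the application spine of a term. [folklore] -/
def spineHead : Term → Term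
  | .app M _ => spineHead M
  | M => M

/-- The spine head of a stacked application. [folklore] -/
theorem spineHead_apps (t : Term) : ∀ args : List Term, spineHead (KAM.apps t args) = spineHead t
  | [] => rfl
  | a :: as => by rw [KAM.apps, spineHead_apps _ as]; rfl

/-- The spine head of a head-reducible term is an abstraction (for `β`) or a sum (for a choice).
[folklore] -/
theorem HdL.spineHead {b : Option Bool} {M N : Term} (h : HdL b M N) :
    (b = none → ∃ P, STA.spineHead M = .lam P) ∧ (∀ bb, b = some bb → ∃ t u, STA.spineHead M = .sum t u) := by
  induction h with
  | beta M N => exact ⟨fun _ => ⟨M, rfl⟩, fun bb h => (by cases h)⟩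
  | choiceL M N => exact ⟨fun h => (by cases h), fun _ _ => ⟨M, N, rfl⟩⟩
  | choiceR M N => exact ⟨fun h => (by cases h), fun _ _ => ⟨M, N, rfl⟩⟩
  | appL N _ ih => exact ih

/-- The spine head of a neutral term is a variable. [folklore] -/
theorem Neutral.spineHead {M : Term} (h : Neutral M) : ∃ j, STA.spineHead M = .var j := by
  induction h with
  | var i => exact ⟨i, rfl⟩
  | app N _ ih => exact ih

/-- A leftmost step of an application spine with a sum at its head is a choice. [folklore] -/
theorem LmoL.label_of_spineHead_sum {b : Option Bool} {M N t u : Term} (h : LmoL b M N) (hs : STA.spineHead M = .sum t u) :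
    ∃ bb, b = some bb := by
  cases h with
  | hd h' =>
    cases b with
    | none => obtain ⟨P, hP⟩ := h'.spineHead.1 rfl; rw [hs] at hP; cases hP
    | some bb => exact ⟨bb, rfl⟩
  | lam _ => simp [STA.spineHead] at hs
  | appL N hM _ => obtain ⟨j, hj⟩ := hM.spineHead; simp only [STA.spineHead] at hs; rw [hs] at hj; cases hj
  | appR hM _ _ => obtain ⟨j, hj⟩ := hM.spineHead; simp only [STA.spineHead] at hs; rw [hs] at hj; cases hj

/-- A stacked application of an application is an application. [folklore] -/
theorem apps_app_exists (X Y : Term) : ∀ (args : List Term), ∃ X' Y', KAM.apps (.app X Y) args = .app X' Y'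
  | [] => ⟨X, Y, rfl⟩
  | a :: as => apps_app_exists (.app X Y) a as

/-- A leftmost step of an application spine with an abstraction at its head (applied) is a `β`.
[folklore] -/
theorem LmoL.label_of_spineHead_lam {b : Option Bool} {M N P A : Term} {args : List Term}
    (h : LmoL b M N) (hM : M = KAM.apps (.app (.lam P) A) args) : b = none := by
  have hs : STA.spineHead M = .lam P := by rw [hM, spineHead_apps]; rfl
  have hne : ∃ X Y, M = .app X Y := by
    obtain ⟨X, Y, h⟩ := apps_app_exists (.lam P) A args
    exact ⟨X, Y, hM.trans h⟩
  obtain ⟨X, Y, rfl⟩ := hne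
  cases h with
  | hd h' =>
    cases b with
    | none => rfl
    | some bb => obtain ⟨t, u, htu⟩ := h'.spineHead.2 bb rfl; rw [hs] at htu; cases htu
  | appL N hX _ => obtain ⟨j, hj⟩ := hX.spineHead; simp only [STA.spineHead] at hs; rw [hs] at hj; cases hj
  | appR hX _ _ => obtain ⟨j, hj⟩ := hX.spineHead; simp only [STA.spineHead] at hs; rw [hs] at hj; cases hj

/-- `x a₁ ⋯ aₙ` with `n` arguments. [folklore] -/
inductive VarApps (j : ℕ) : ℕ → Term → Prop
  | var : VarApps j 0 (.var j)
  | app {n : ℕ} {t : Term} (a : Term) (h : VarApps j n t) : VarApps j (n + 1) (.app t a)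

/-- Stacked applications of a variable have that shape. [folklore] -/
theorem VarApps.apps (j : ℕ) : ∀ (args : List Term) {n : ℕ} {t : Term}, VarApps j n t →
    VarApps j (n + args.length) (KAM.apps t args)
  | [], _, _, h => h
  | a :: as, n, t, h => by
    have := VarApps.apps j as (VarApps.app a h)
    simpa [KAM.apps, Nat.add_assoc, Nat.add_comm 1] using this

/-- Terms of shape `x a⃗` are neutral. [folklore] -/
theorem VarApps.neutral {j n : ℕ} {t : Term} (h : VarApps j n t) : Neutral t := by
  induction h with
  | var => exact Neutral.var j
  | app a _ ih => exact Neutral.app a ih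

/-- A leftmost step from `x a⃗` stays of shape `x a⃗'` with as many arguments. [folklore] -/
theorem LmoL.varApps_shape {b : Option Bool} {M N : Term} (h : LmoL b M N) {j n : ℕ} (hM : VarApps j n M) :
    VarApps j n N := by
  induction h generalizing n with
  | hd h' => exact absurd h'.toHd (fun hh => hM.neutral.not_hd hh)
  | lam _ _ => cases hM
  | appL N _ _ ih =>
    cases hM with
    | app a h0 => exact VarApps.app N (ih h0)
  | appR _ _ _ _ =>
    cases hM with
    | app a h0 => exact VarApps.app _ h0

/-- A leftmost step under `D` abstractions of a term of shape `x a⃗` keeps that shape. [folklore] -/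
theorem LmoL.lams_varApps_shape {b : Option Bool} {D : ℕ} : ∀ {M N : Term}, LmoL b (KAM.lams D M) N →
    ∀ {j n : ℕ}, VarApps j n M → ∃ M', N = KAM.lams D M' ∧ VarApps j n M' := by
  induction D with
  | zero => intro M N h j n hM; exact ⟨N, rfl, h.varApps_shape hM⟩
  | succ D ih =>
    intro M N h j n hM
    simp only [KAM.lams] at h
    cases h with
    | hd h' => cases h'
    | lam h' =>
      obtain ⟨M', rfl, hM'⟩ := ih h' hM
      exact ⟨M', rfl, hM'⟩

/-- `0` is not of the shape `λᴰ (x a⃗)` unless `D = 2`, no arguments, and `x` the outer variable.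
[cite: GaboardiMarionRonchidellarocca2008, §3.2 (0 ≐ λxy.x)] -/
theorem lams_varApps_eq_zero {D j n : ℕ} {M : Term} (hM : VarApps j n M) (hD : D ≤ 2) (h : KAM.lams D M = zero) :
    D = 2 ∧ n = 0 ∧ j = 1 := by
  rcases D with _ | _ | _ | D
  · simp only [KAM.lams] at h; subst h; cases hM
  · simp only [KAM.lams, zero, Term.lam.injEq] at h; subst h; cases hM
  · simp only [KAM.lams, zero, Term.lam.injEq] at h
    subst h
    cases hM
    exact ⟨rfl, rfl, rfl⟩
  · omega

/-- A labelled sequence from `λᴰ (x a⃗)` reaching `0` forces `D = 2`, no arguments, `x` the outer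
variable. [folklore] -/
theorem RelL.lams_varApps_zero {bs : List (Option Bool)} {D : ℕ} {M : Term} (h : RelL bs (KAM.lams D M) zero)
    {j n : ℕ} (hM : VarApps j n M) (hD : D ≤ 2) : D = 2 ∧ n = 0 ∧ j = 1 := by
  generalize e : KAM.lams D M = T at h
  generalize ez : zero = Z at h
  revert ez
  induction h generalizing M with
  | nil T => intro ez; exact lams_varApps_eq_zero hM hD (e.trans ez.symm)
  | cons h' _ ih =>
    intro ez
    subst e
    obtain ⟨M', rfl, hM'⟩ := h'.lams_varApps_shape hM
    exact ih hM' rfl ez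

/-- A leftmost step under three abstractions stays under three abstractions. [folklore] -/
theorem LmoL.lams_three_shape {b : Option Bool} {M N : Term} (h : LmoL b (KAM.lams 3 M) N) : ∃ M', N = KAM.lams 3 M' := by
  simp only [KAM.lams] at h ⊢
  cases h with
  | hd h' => cases h'
  | lam h₁ =>
    cases h₁ with
    | hd h' => cases h'
    | lam h₂ =>
      cases h₂ with
      | hd h' => cases h'
      | lam h₃ => exact ⟨_, rfl⟩

/-- No labelled sequence leads from a triple abstraction to `0`. [folklore] -/
theorem RelL.lams_three_ne_zero {bs : List (Option Bool)} {M : Term} (h : RelL bs (KAM.lams 3 M) zero) : False := by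
  generalize e : KAM.lams 3 M = T at h
  generalize ez : zero = Z at h
  revert ez
  induction h generalizing M with
  | nil T =>
    intro ez
    subst e
    simp [KAM.lams, zero] at ez
  | cons h' _ ih =>
    intro ez
    subst e
    obtain ⟨M', rfl⟩ := h'.lams_three_shape
    exact ih rfl ez

/-- Peeling the entered abstractions off a labelled leftmost step. [folklore] -/
theorem LmoL.of_lams {b : Option Bool} {D : ℕ} : ∀ {M N : Term}, LmoL b (KAM.lams D M) N →
    (∀ P, M ≠ .lam P) → ∃ M', N = KAM.lams D M' ∧ LmoL b M M' := by
  induction D with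
  | zero => intro M N h _; exact ⟨N, rfl, h⟩
  | succ D ih =>
    intro M N h hM
    simp only [KAM.lams] at h
    cases h with
    | hd h' => cases h'
    | lam h' =>
      obtain ⟨M', rfl, hM'⟩ := ih h' hM
      exact ⟨M', rfl, hM'⟩

/-- A stacked application is never an abstraction (when the head is not, with no arguments).
[folklore] -/
theorem apps_ne_lam {t : Term} (ht : ∀ P, t ≠ .lam P) : ∀ (args : List Term) (P : Term), KAM.apps t args ≠ .lam P
  | [], P => ht P
  | a :: as, P => apps_ne_lam (t := .app t a) (fun P h => by cases h) as P

end STA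

end Literature.Computability.ImplicitComplexity
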